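import Mathlib

/-!
# T5SimpleQuotient — «a non-zero big theta has an irreducible quotient»

Kernel witness (cell pub-hodge-repro2, seat p3, Tier-5 support for sub-step N2 / N3) for the
one-line [A] of route/T5-N2-route-3.md §N2.10.2:

«σ̄_v occurs in our lift to H_d ⟺ π := σ̄_v ⊗ ν^{−1}∘det has a GRS Howe lift to H_d for (γ, ψ_v)
(a non-zero big theta has an irreducible quotient, so «occurs» = «Hom ≠ 0 for some irreducible σ»)
[A]»

and of the same inference in route/T5-N3-route-2.md §N3.11.4 (r2) («an irreducible quotient of a
finite-length module …»; the existence half: a finite-length module that is non-zero HAS one).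

What is kernel-checked here (Mathlib only): over any ring `R`,

* `exists_isCoatom`: a non-zero finitely generated module has a maximal proper submodule
  (Mathlib: `Submodule R M` is coatomic when `M` is finitely generated);
* `exists_isSimpleModule_quotient`: hence a simple (= irreducible) quotient `M ⧸ N`
  (`isSimpleModule_iff_isCoatom`);
* `exists_simple_quotient_map_ne_zero`: «Hom ≠ 0 for some irreducible»: the projection onto
  that quotient is a non-zero linear map to a simple module;
* `exists_isSimpleModule_quotient_of_isNoetherian`, `…_of_isFiniteLength`: the same for Noetherian
  modules and for modules of finite length (Mathlib `IsFiniteLength` = Noetherian ∧ Artinian) — the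
  printed hypothesis on the big theta («Θ(π) has finite length, shown by Kudla», [GT-Theta]).

What stays prose (labels unchanged): that the big theta is a module of finite length over the
relevant algebra (the cited printed fact), and that «irreducible quotient» in the printed text is
the simple quotient of the underlying module.

README §8(d): this file uses an L-value-free non-vanishing device: NO.
-/

namespace Summit.Ventures.HodgeRepro2.T5SimpleQuotient

variable {R M : Type*} [Ring R] [AddCommGroup M] [Module R M]

/-- A non-zero finitely generated module has a maximal proper submodule. -/
theorem exists_isCoatom [Module.Finite R M] [Nontrivial M] : ∃ N : Submodule R M, IsCoatom N :=
  IsCoatomic.exists_coatom (Submodule R M)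

/-- A non-zero finitely generated module has a simple (irreducible) quotient. -/
theorem exists_isSimpleModule_quotient [Module.Finite R M] [Nontrivial M] :
    ∃ N : Submodule R M, IsSimpleModule R (M ⧸ N) := by
  obtain ⟨N, hN⟩ := exists_isCoatom (R := R) (M := M)
  exact ⟨N, isSimpleModule_iff_isCoatom.mpr hN⟩

/-- The projection onto a simple quotient is a non-zero map: «occurs» = «Hom ≠ 0 for some
irreducible». -/
theorem exists_simple_quotient_map_ne_zero [Module.Finite R M] [Nontrivial M] :
    ∃ N : Submodule R M, IsSimpleModule R (M ⧸ N) ∧ N.mkQ ≠ 0 := by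
  obtain ⟨N, hN⟩ := exists_isSimpleModule_quotient (R := R) (M := M)
  refine ⟨N, hN, fun h => ?_⟩
  have htop : N = ⊤ := by
    rw [eq_top_iff]
    intro x _
    have hx := LinearMap.congr_fun h x
    rw [Submodule.mkQ_apply, LinearMap.zero_apply, Submodule.Quotient.mk_eq_zero] at hx
    exact hx
  haveI : Subsingleton (M ⧸ N) := Submodule.Quotient.subsingleton_iff.mpr htop
  haveI : Nontrivial (M ⧸ N) := IsSimpleModule.nontrivial R (M ⧸ N)
  exact false_of_nontrivial_of_subsingleton (M ⧸ N)

/-- A non-zero Noetherian module has a simple quotient. -/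
theorem exists_isSimpleModule_quotient_of_isNoetherian [IsNoetherian R M] [Nontrivial M] :
    ∃ N : Submodule R M, IsSimpleModule R (M ⧸ N) :=
  exists_isSimpleModule_quotient

/-- A non-zero module of finite length has a simple quotient (the printed hypothesis on the big
theta: finite length). -/
theorem exists_isSimpleModule_quotient_of_isFiniteLength (h : IsFiniteLength R M) [Nontrivial M] :
    ∃ N : Submodule R M, IsSimpleModule R (M ⧸ N) := by
  haveI : IsNoetherian R M := (isFiniteLength_iff_isNoetherian_isArtinian.mp h).1
  exact exists_isSimpleModule_quotient

end Summit.Ventures.HodgeRepro2.T5SimpleQuotient
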